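import Literature.NumberTheory.Automorphic.GodementJacquetZetaKernelTheta
import HarnessLib

/-!
# The dual term of the reflection formula as a shifted zeta integral of `Φ̂(x⁻¹)` over `{|det| < 1}`,
# and its analyticity

Topic `NumberTheory/Automorphic`; namespace `Literature.NumberTheory.Automorphic`. A brick of the
discharge of `GodementJacquet1972_gjZeta_meromorphic` (Godement–Jacquet (1972), §13, proof of
Thm. 13.8: the second term `∫_{|det x| ≤ 1} Φ̂(x⁻¹) … |det x|^{s-n} dx` of the analytic continuation
converges for all `s`). For the dual test function `gjDualF n K Ψ w = Ψ |det|^w 𝟙_{|det| > 1}` of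
`GodementJacquetZetaKernelTheta`:

* `integral_gjDualF_inv_mul_glMatrixCoeff_eq_gjZeta` — **the dual term is a shifted truncated zeta
  integral**: `∫_G F'_w(g⁻¹) ⟪φ', R(g) φ⟫ dν(g) = gjZeta μ (ν|_{|det|<1}) (fun m => Ψ m⁻¹) φ φ' (-w)`;
* `integrable_norm_comp_inv_mul_rpow_restrict_compl` — the majorants `‖Ψ(x⁻¹)‖ |det x|^σ` are
  integrable on `{|det| < 1}` for **every** real `σ` (`x ↦ x⁻¹`, inversion invariance of Haar
  measure on the unimodular `GL_n(𝔸_K)`, and the half-plane bounds of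
  `GodementJacquetGlobalConvergence` / `GodementJacquetGlobalHolomorphy` on `{|det| ≥ 1}`);
* `differentiable_gjZeta_restrict_compl_comp_inv`,
  `differentiable_integral_gjDualF_inv_mul_glMatrixCoeff` — **the dual term
  `s ↦ ∫_G F'_{n-s}(g⁻¹) ⟪φ', R(g) φ⟫ dν(g)` is entire.**

Everything is proved; no definitions.

## References

* R. Godement, H. Jacquet, *Zeta functions of simple algebras*, LNM 260 (1972), §13 (proof of
  Thm. 13.8) [GodementJacquet1972].
-/

noncomputable section

open MeasureTheory Measure Set Filter Topology IsDedekindDomain NumberField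
open Literature.MeasureTheory.Group
open scoped ENNReal NNReal ComplexConjugate MatrixGroups

namespace Literature.NumberTheory.Automorphic

section DualTerm

variable {n : ℕ} {K : Type} [Field K] [NumberField K]

attribute [local instance] adelicBorel borelSpace_adelic locallyCompactSpace_adelic
  secondCountableTopology_gl_adelic glBorel borelSpace_glBorel isHaarMeasure_glForm

variable (μ : Measure (AdelicGroupData.gl n K).automorphicQuotient)
  [(AdelicGroupData.gl n K).IsAutomorphicMeasure μ]

/-- The matrix of `g⁻¹` is the matrix inverse of the matrix of `g`. [folklore] -/
theorem coe_inv_eq_inv_coe (g : GL (Fin n) (AdeleRing (𝓞 K) K)) :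
    ((g⁻¹ : GL (Fin n) (AdeleRing (𝓞 K) K)) : Matrix (Fin n) (Fin n) (AdeleRing (𝓞 K) K)) =
      (g : Matrix (Fin n) (Fin n) (AdeleRing (𝓞 K) K))⁻¹ :=
  Matrix.coe_units_inv g

/-- `|det g⁻¹|_𝔸^w = |det g|_𝔸^{-w}` as complex powers. [folklore] -/
theorem adelicAbsDet_inv_cpow (g : GL (Fin n) (AdeleRing (𝓞 K) K)) (w : ℂ) :
    (((adelicAbsDet n K g⁻¹ : ℝ≥0) : ℝ) : ℂ) ^ w = (((adelicAbsDet n K g : ℝ≥0) : ℝ) : ℂ) ^ (-w) := by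
  have hpos : (0 : ℝ) < (adelicAbsDet n K g : ℝ) := adelicAbsDet_pos g
  have harg : ((adelicAbsDet n K g : ℝ) : ℂ).arg ≠ Real.pi := by
    rw [Complex.arg_ofReal_of_nonneg hpos.le]; exact Real.pi_pos.ne
  rw [map_inv, NNReal.coe_inv, Complex.ofReal_inv, Complex.inv_cpow _ _ harg, Complex.cpow_neg]

/-- Pointwise: `F'_w(g⁻¹) ⟪φ', R(g) φ⟫ = 𝟙_{|det g| < 1} · (Ψ((↑g)⁻¹) ⟪φ', R(g) φ⟫ |det g|^{-w})`.
[folklore] -/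
theorem gjDualF_inv_mul_glMatrixCoeff_eq_indicator (Ψ : Matrix (Fin n) (Fin n) (AdeleRing (𝓞 K) K) → ℂ)
    (w : ℂ) (φ φ' : (AdelicGroupData.gl n K).L2 μ) (g : GL (Fin n) (AdeleRing (𝓞 K) K)) :
    gjDualF n K Ψ w g⁻¹ * glMatrixCoeff μ φ φ' g =
      (detAtLeastOne n K)ᶜ.indicator
        (gjZetaIntegrand μ (fun m => Ψ m⁻¹) φ φ' (-w)) g := by
  rw [gjDualF_apply]
  by_cases hg : g ∈ (detAtLeastOne n K)ᶜ
  · rw [Set.indicator_of_mem ((inv_mem_detGtOne_iff g).2 hg), Set.indicator_of_mem hg, gjZetaIntegrand,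
      coe_inv_eq_inv_coe, adelicAbsDet_inv_cpow]
    ring
  · rw [Set.indicator_of_notMem (fun h => hg ((inv_mem_detGtOne_iff g).1 h)), Set.indicator_of_notMem hg,
      zero_mul]

/-- **The dual term is a shifted truncated zeta integral of `x ↦ Φ̂(x⁻¹)`**:
`∫_G F'_w(g⁻¹) ⟪φ', R(g) φ⟫ dν(g) = Z^{<1}(Ψ̃, -w, φ, φ')` with `Ψ̃(m) = Ψ(m⁻¹)`, i.e.
`gjZeta μ (ν|_{|det|<1}) (fun m => Ψ m⁻¹) φ φ' (-w)` (for `Ψ = Φ̂`, `w = n - s`: the integral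
`∫_{|det x| < 1} Φ̂(x⁻¹) ⟪φ', R(x) φ⟫ |det x|^{s-n} dx`, Godement–Jacquet (1972), §13, the second
term of the analytic continuation of `Z`). [cite: GodementJacquet1972, §13] -/
theorem integral_gjDualF_inv_mul_glMatrixCoeff_eq_gjZeta (Ψ : Matrix (Fin n) (Fin n) (AdeleRing (𝓞 K) K) → ℂ)
    (w : ℂ) (φ φ' : (AdelicGroupData.gl n K).L2 μ) (ν : Measure (AdelicGroupData.gl n K).Adelic) :
    ∫ g : GL (Fin n) (AdeleRing (𝓞 K) K), gjDualF n K Ψ w g⁻¹ * glMatrixCoeff μ φ φ' g ∂ν =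
      gjZeta μ (ν.restrict (detAtLeastOne n K)ᶜ) (fun m => Ψ m⁻¹) φ φ' (-w) := by
  have h1 : ∫ g : GL (Fin n) (AdeleRing (𝓞 K) K), gjDualF n K Ψ w g⁻¹ * glMatrixCoeff μ φ φ' g ∂ν =
      ∫ g : GL (Fin n) (AdeleRing (𝓞 K) K), (detAtLeastOne n K)ᶜ.indicator
        (gjZetaIntegrand μ (fun m => Ψ m⁻¹) φ φ' (-w)) g ∂ν :=
    integral_congr_ae (Eventually.of_forall fun g => gjDualF_inv_mul_glMatrixCoeff_eq_indicator μ Ψ w φ φ' g)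
  rw [h1]
  exact integral_indicator (measurableSet_detAtLeastOne (n := n) (K := K)).compl

/-- `x ↦ Ψ((↑x)⁻¹)` is continuous on `GL_n(𝔸_K)` for `Ψ ∈ 𝒮(M_n(𝔸_K))`. [folklore] -/
theorem continuous_comp_coe_inv {Ψ : Matrix (Fin n) (Fin n) (AdeleRing (𝓞 K) K) → ℂ}
    (hΨ : Ψ ∈ schwartzBruhatAdelicMatrix n K) :
    Continuous fun x : GL (Fin n) (AdeleRing (𝓞 K) K) =>
      (fun m : Matrix (Fin n) (Fin n) (AdeleRing (𝓞 K) K) => Ψ m⁻¹) (x : Matrix (Fin n) (Fin n) (AdeleRing (𝓞 K) K)) := by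
  have h : (fun x : GL (Fin n) (AdeleRing (𝓞 K) K) =>
      (fun m : Matrix (Fin n) (Fin n) (AdeleRing (𝓞 K) K) => Ψ m⁻¹) (x : Matrix (Fin n) (Fin n) (AdeleRing (𝓞 K) K))) =
      fun x => Ψ ((x⁻¹ : GL (Fin n) (AdeleRing (𝓞 K) K)) : Matrix (Fin n) (Fin n) (AdeleRing (𝓞 K) K)) := by
    funext x; simp only [coe_inv_eq_inv_coe]
  rw [h]
  exact (continuous_of_mem_schwartzBruhatAdelicMatrix hΨ).comp (Units.continuous_val.comp continuous_inv)

/-- **Integrability of the reflected majorants on `{|det| < 1}` for every real exponent**: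
`∫_{|det x| < 1} ‖Ψ(x⁻¹)‖ |det x|^σ dν(x) = ∫_{|det u| > 1} ‖Ψ(u)‖ |det u|^{-σ} dν(u) < ∞`
(`u = x⁻¹`, `ν` inversion invariant; on `{|det| ≥ 1}` every exponent is dominated by `n² + n + 2`,
where `GodementJacquetGlobalConvergence` applies). [folklore] -/
theorem integrable_norm_comp_inv_mul_rpow_restrict_compl
    {Ψ : Matrix (Fin n) (Fin n) (AdeleRing (𝓞 K) K) → ℂ} (hΨ : Ψ ∈ schwartzBruhatAdelicMatrix n K) (σ : ℝ)
    (ν : Measure (AdelicGroupData.gl n K).Adelic) [ν.IsHaarMeasure] :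
    Integrable (fun x : GL (Fin n) (AdeleRing (𝓞 K) K) =>
        ‖(fun m : Matrix (Fin n) (Fin n) (AdeleRing (𝓞 K) K) => Ψ m⁻¹) (x : Matrix (Fin n) (Fin n) (AdeleRing (𝓞 K) K))‖ *
          (adelicAbsDet n K x : ℝ) ^ σ)
      ((ν : Measure (GL (Fin n) (AdeleRing (𝓞 K) K))).restrict (detAtLeastOne n K)ᶜ) := by
  haveI hinv : ν.IsInvInvariant := isInvInvariant_of_isHaarMeasure_gl n K ν
  haveI : @Measure.IsInvInvariant (GL (Fin n) (AdeleRing (𝓞 K) K)) (glBorel n K) _ ν := hinv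
  -- the majorant on `{|det| ≥ 1}` with exponent `-σ`
  have hΨc : Continuous fun u : GL (Fin n) (AdeleRing (𝓞 K) K) =>
      Ψ (u : Matrix (Fin n) (Fin n) (AdeleRing (𝓞 K) K)) :=
    (continuous_of_mem_schwartzBruhatAdelicMatrix hΨ).comp Units.continuous_val
  have hmaj : Integrable (fun u : GL (Fin n) (AdeleRing (𝓞 K) K) =>
      ‖Ψ (u : Matrix (Fin n) (Fin n) (AdeleRing (𝓞 K) K))‖ * (adelicAbsDet n K u : ℝ) ^ (-σ))
      ((ν : Measure (GL (Fin n) (AdeleRing (𝓞 K) K))).restrict (detAtLeastOne n K)) := by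
    by_cases hcase : -σ ≤ (n : ℝ) * n + n + 2
    · have h0 : Integrable (fun u : GL (Fin n) (AdeleRing (𝓞 K) K) =>
          ‖Ψ (u : Matrix (Fin n) (Fin n) (AdeleRing (𝓞 K) K))‖ * (adelicAbsDet n K u : ℝ) ^ ((n : ℝ) * n + n + 2))
          ((ν : Measure (GL (Fin n) (AdeleRing (𝓞 K) K))).restrict (detAtLeastOne n K)) :=
        (integrable_norm_mul_adelicAbsDet_rpow_of_mem_schwartzBruhat
          (ν : Measure (GL (Fin n) (AdeleRing (𝓞 K) K))) hΨ le_rfl).mono_measure Measure.restrict_le_self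
      exact integrable_norm_mul_rpow_restrict_detAtLeastOne_of_le
        (ν := (ν : Measure (GL (Fin n) (AdeleRing (𝓞 K) K)))) hΨc.aestronglyMeasurable
        continuous_adelicAbsDet.aemeasurable hcase h0
    · have hcase' : (n : ℝ) * n + n + 2 ≤ -σ := (lt_of_not_ge hcase).le
      exact (integrable_norm_mul_adelicAbsDet_rpow_of_mem_schwartzBruhat
        (ν : Measure (GL (Fin n) (AdeleRing (𝓞 K) K))) hΨ hcase').mono_measure Measure.restrict_le_self
  -- pass to indicators on the whole group and substitute `x ↦ x⁻¹`
  refine (integrable_indicator_iff (measurableSet_detAtLeastOne (n := n) (K := K)).compl).1 ?_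
  have hmaj2 := (integrable_indicator_iff (measurableSet_detAtLeastOne (n := n) (K := K))).2 hmaj
  have hmaj' := hmaj2.comp_inv
  refine (hmaj'.mono' ?_ (Eventually.of_forall fun x => ?_))
  · refine AEStronglyMeasurable.indicator ?_ (measurableSet_detAtLeastOne (n := n) (K := K)).compl
    exact ((continuous_comp_coe_inv hΨ).norm.mul (continuous_adelicAbsDet.rpow_const
      fun _ => Or.inl (adelicAbsDet_pos _).ne')).aestronglyMeasurable
  · -- pointwise comparison of the two indicators (in fact an equality)
    rw [Real.norm_eq_abs]
    by_cases hx : x ∈ (detAtLeastOne n K)ᶜ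
    · have hx' : x⁻¹ ∈ detAtLeastOne n K := by
        rw [mem_detAtLeastOne_iff]
        exact le_of_lt ((mem_detGtOne_iff _).1 ((inv_mem_detGtOne_iff x).2 hx))
      rw [Set.indicator_of_mem hx, Set.indicator_of_mem hx', coe_inv_eq_inv_coe, map_inv, NNReal.coe_inv,
        Real.inv_rpow (adelicAbsDet_pos x).le, Real.rpow_neg (adelicAbsDet_pos x).le, inv_inv,
        abs_of_nonneg (by positivity)]
    · rw [Set.indicator_of_notMem hx, abs_zero]
      exact Set.indicator_nonneg (fun u _ => by positivity) _

/-- **The reflected truncated zeta integral `s ↦ Z^{<1}(Ψ̃, s, φ, φ')`, `Ψ̃(m) = Ψ(m⁻¹)`, is entire**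
(for `Ψ ∈ 𝒮(M_n(𝔸_K))`, any `φ, φ' ∈ L²`, automorphic `μ`, Haar `ν`): the majorants
`‖Ψ(x⁻¹)‖ |det x|^σ` are integrable on `{|det| < 1}` for every real `σ`
(`integrable_norm_comp_inv_mul_rpow_restrict_compl`), so
`differentiable_gjZeta_of_forall_integrable` applies. Godement–Jacquet (1972), §13 (proof of
Thm. 13.8: the integral `∫_{|det| ≤ 1} Φ̂(x⁻¹) … |det x|^{s-n}` converges for all `s`).
[cite: GodementJacquet1972, §13 (proof of Thm. 13.8)] -/
theorem differentiable_gjZeta_restrict_compl_comp_inv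
    {Ψ : Matrix (Fin n) (Fin n) (AdeleRing (𝓞 K) K) → ℂ} (hΨ : Ψ ∈ schwartzBruhatAdelicMatrix n K)
    (φ φ' : (AdelicGroupData.gl n K).L2 μ) (ν : Measure (AdelicGroupData.gl n K).Adelic) [ν.IsHaarMeasure] :
    Differentiable ℂ (gjZeta μ ((ν : Measure (GL (Fin n) (AdeleRing (𝓞 K) K))).restrict (detAtLeastOne n K)ᶜ)
      (fun m : Matrix (Fin n) (Fin n) (AdeleRing (𝓞 K) K) => Ψ m⁻¹) φ φ') :=
  differentiable_gjZeta_of_forall_integrable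
    (fun s => aestronglyMeasurable_gjZetaIntegrand (Φ := fun m : Matrix (Fin n) (Fin n) (AdeleRing (𝓞 K) K) => Ψ m⁻¹)
      (continuous_comp_coe_inv hΨ) φ φ' s _)
    (fun σ => integrable_norm_comp_inv_mul_rpow_restrict_compl hΨ σ ν)

/-- **The dual term `s ↦ ∫_G F'_{n-s}(g⁻¹) ⟪φ', R(g) φ⟫ dν(g)` is entire** (it is
`Z^{<1}(Ψ̃, s - n, φ, φ')`). [cite: GodementJacquet1972, §13 (proof of Thm. 13.8)] -/
theorem differentiable_integral_gjDualF_inv_mul_glMatrixCoeff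
    {Ψ : Matrix (Fin n) (Fin n) (AdeleRing (𝓞 K) K) → ℂ} (hΨ : Ψ ∈ schwartzBruhatAdelicMatrix n K)
    (φ φ' : (AdelicGroupData.gl n K).L2 μ) (ν : Measure (AdelicGroupData.gl n K).Adelic) [ν.IsHaarMeasure] :
    Differentiable ℂ fun s : ℂ =>
      ∫ g : GL (Fin n) (AdeleRing (𝓞 K) K), gjDualF n K Ψ ((n : ℂ) - s) g⁻¹ * glMatrixCoeff μ φ φ' g ∂ν := by
  have h : (fun s : ℂ =>
      ∫ g : GL (Fin n) (AdeleRing (𝓞 K) K), gjDualF n K Ψ ((n : ℂ) - s) g⁻¹ * glMatrixCoeff μ φ φ' g ∂ν) =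
      fun s => gjZeta μ ((ν : Measure (GL (Fin n) (AdeleRing (𝓞 K) K))).restrict (detAtLeastOne n K)ᶜ)
        (fun m : Matrix (Fin n) (Fin n) (AdeleRing (𝓞 K) K) => Ψ m⁻¹) φ φ' (s - n) := by
    funext s
    rw [integral_gjDualF_inv_mul_glMatrixCoeff_eq_gjZeta μ Ψ ((n : ℂ) - s) φ φ' ν, neg_sub]
  rw [h]
  exact (differentiable_gjZeta_restrict_compl_comp_inv μ hΨ φ φ' ν).comp
    (differentiable_id.sub (differentiable_const _))

end DualTerm

end Literature.NumberTheory.Automorphic
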